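import Mathlib
import Summits.Ventures.PercRepro.TriangleCapRegularCellNine

/-!
# PercRepro — THE REGULAR CELL `t = 14 D`: THE BLOCKS, PART A (p3, gen 57)

The row-size lists realising the excess values (rows of `14`, `28` or `42` edges), part A.  Axioms: standard.
-/

namespace PercRepro

namespace TriangleCap

namespace C047

open Finset

/-- The blocks, range `13 ≤ e ≤ 86`. -/
def blockFourteenA (e : ℕ) : List ℕ :=
  if e = 13 then [13, 1]
  else if e = 24 then [12, 2]
  else if e = 25 then [12, 1, 1]
  else if e = 26 then [13, 13, 1, 1]
  else if e = 33 then [11, 3]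
  else if e = 35 then [11, 2, 1]
  else if e = 36 then [11, 1, 1, 1]
  else if e = 37 then [13, 12, 2, 1]
  else if e = 38 then [13, 12, 1, 1, 1]
  else if e = 39 then [13, 13, 13, 1, 1, 1]
  else if e = 40 then [10, 4]
  else if e = 43 then [10, 3, 1]
  else if e = 44 then [10, 2, 2]
  else if e = 45 then [9, 5]
  else if e = 46 then [10, 1, 1, 1, 1]
  else if e = 47 then [12, 12, 3, 1]
  else if e = 48 then [8, 6]
  else if e = 49 then [7, 7]
  else if e = 50 then [12, 12, 1, 1, 1, 1]
  else if e = 51 then [9, 3, 2]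
  else if e = 52 then [9, 3, 1, 1]
  else if e = 53 then [8, 5, 1]
  else if e = 54 then [9, 2, 1, 1, 1]
  else if e = 55 then [7, 6, 1]
  else if e = 56 then [8, 4, 2]
  else if e = 57 then [8, 3, 3]
  else if e = 58 then [13, 9, 5, 1]
  else if e = 59 then [7, 5, 2]
  else if e = 60 then [6, 6, 2]
  else if e = 61 then [7, 4, 3]
  else if e = 62 then [8, 2, 1, 1, 1, 1]
  else if e = 63 then [6, 5, 3]
  else if e = 64 then [6, 4, 4]
  else if e = 65 then [5, 5, 4]
  else if e = 66 then [6, 5, 1, 1, 1]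
  else if e = 67 then [6, 4, 3, 1]
  else if e = 68 then [5, 5, 3, 1]
  else if e = 69 then [5, 4, 4, 1]
  else if e = 70 then [5, 5, 2, 1, 1]
  else if e = 71 then [5, 4, 3, 2]
  else if e = 72 then [4, 4, 4, 2]
  else if e = 73 then [4, 4, 3, 3]
  else if e = 74 then [5, 3, 3, 2, 1]
  else if e = 75 then [4, 4, 3, 2, 1]
  else if e = 76 then [4, 3, 3, 3, 1]
  else if e = 77 then [4, 3, 3, 2, 2]
  else if e = 78 then [3, 3, 3, 3, 2]
  else if e = 79 then [3, 3, 3, 3, 1, 1]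
  else if e = 80 then [3, 3, 3, 2, 2, 1]
  else if e = 81 then [3, 3, 2, 2, 2, 2]
  else if e = 82 then [3, 3, 2, 2, 2, 1, 1]
  else if e = 83 then [3, 2, 2, 2, 2, 2, 1]
  else if e = 84 then [2, 2, 2, 2, 2, 2, 2]
  else if e = 85 then [2, 2, 2, 2, 2, 2, 1, 1]
  else [2, 2, 2, 2, 2, 1, 1, 1, 1]


end C047

end TriangleCap

end PercRepro
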